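import Summits.KontsevichZagierPeriods.KontsevichZagierPeriods.Theorems.RootDecompZetaThreeFrontierGZLadderThreeWlog

/-! # decomp-kz lens-1 gen 11 — `OrdersThree.lean`: §23 THE FIVE ORDERS OF A REDUCED DATUM and the REGISTERED stub
`gz_ladder.stub_three_orders` (skeleton v3 @1c2778ca on stmt-KontsevichZagierPeriods-32433) BY NAME AND SIGNATURE.

SELF-CONTAINED LANDING UNIT (census-1 g8 request shape, 14:05:58Z): imports ONLY the landed tree module
`…Theorems.RootDecompZetaThreeFrontierGZLadderThreeWlog` (p775955; transitively …WordFacesThreeP1–P3, …WordMoves, …WordMovesPole), re-declares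
NOTHING that is public in the tree (the three `snoc` helpers and `ae_integrableOn_snoc` are private upstream, hence private copies here), and ends
with the by-name block: `dual3`, `diag3`, `IsReducedOrdThree` (token-identical to skeleton v3) and `theorem stub_three_orders`.  Body = §23 of
`WordLayer.lean` v2 (namespace `…Theorems.RootDecompZetaThreeFrontierWordMoves`, as the landed §22 parts): the cube `Cube3`, the vertex chart
`vΨ (x₀,x₁,s) ↦ (s, s x₀, s x₀ x₁)` with Jacobian `y₂²y₀` (`integrableOn_vchart`), the swap, monomial lifts, `vertex_order`, `edge_order`,
`reduced_orders`, `reducedOrders_of_isReduced_three`.  farm `lean check`: rc 0, 0 errors, 0 warnings, 0 sorries; standard axioms (audit pinned). -/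

/-! # `RootDecompZetaThreeFrontierWordOrdersThreeP1` — part 1/3 of the mechanical ≤330-line split of `OrdersThree.stripped.lean`
(split by the decomp-kz census seat for landing; mathematics unchanged). -/

noncomputable section

set_option linter.dupNamespace false

open Set MeasureTheory MvPolynomial
open Literature.NumberTheory.Transcendental
open Literature.ModelTheory.ExponentialFields (IsSemialgebraic)

namespace Summit.KontsevichZagierPeriods.KontsevichZagierPeriods.Theorems.RootDecompZetaThreeFrontierWordMoves

/-! ### COPIES of g10-local / private lemmas (delete at splice) -/

/-- Auxiliary step `continuous_snoc`. [bookkeeping] -/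
private theorem continuous_snoc {N : ℕ} (x : Fin N → ℝ) :
    Continuous fun t : ℝ => (Fin.snoc x t : Fin (N + 1) → ℝ) := by
  refine continuous_pi fun j => ?_
  refine Fin.lastCases ?_ (fun i => ?_) j
  · simpa using continuous_id'
  · simpa using continuous_const

/-- Auxiliary step `exists_measurableEquiv_snoc`. [bookkeeping] -/
private theorem exists_measurableEquiv_snoc (N : ℕ) :
    ∃ e : (Fin (N + 1) → ℝ) ≃ᵐ (Fin N → ℝ) × ℝ,
      MeasurePreserving e volume ((volume : Measure (Fin N → ℝ)).prod (volume : Measure ℝ)) ∧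
      ∀ q, e.symm q = Fin.snoc q.1 q.2 := by
  refine ⟨(MeasurableEquiv.piFinSuccAbove (fun _ => ℝ) (Fin.last N)).trans
    MeasurableEquiv.prodComm, ?_, fun q => ?_⟩
  · refine (volume_preserving_piFinSuccAbove (fun _ => ℝ) (Fin.last N)).trans ?_
    rw [Measure.volume_eq_prod]
    exact Measure.measurePreserving_swap
  · show (MeasurableEquiv.piFinSuccAbove (fun _ => ℝ) (Fin.last N)).symm (q.2, q.1) = _
    rw [MeasurableEquiv.piFinSuccAbove_symm_apply, Fin.insertNthEquiv_last]
    rfl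

/-- Auxiliary step `ae_integrableOn_snoc`. [bookkeeping] -/
private theorem ae_integrableOn_snoc {N : ℕ} {B : Set (Fin (N + 1) → ℝ)} (hB : MeasurableSet B)
    {f : (Fin (N + 1) → ℝ) → ℝ} (hf : IntegrableOn f B) :
    ∀ᵐ x : Fin N → ℝ, IntegrableOn (fun t : ℝ => f (Fin.snoc x t))
      {t | (Fin.snoc x t : Fin (N + 1) → ℝ) ∈ B} := by
  obtain ⟨e, he, he_symm⟩ := exists_measurableEquiv_snoc N
  have h1 : Integrable (B.indicator f) volume := (integrable_indicator_iff hB).2 hf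
  have h2 : Integrable (B.indicator f ∘ e.symm) ((volume : Measure (Fin N → ℝ)).prod volume) :=
    ((he.symm e).integrable_comp_emb e.symm.measurableEmbedding).2 h1
  refine (h2.prod_right_ae).mono fun x hx => ?_
  have hm : MeasurableSet {t : ℝ | (Fin.snoc x t : Fin (N + 1) → ℝ) ∈ B} :=
    (continuous_snoc x).measurable hB
  refine (integrable_indicator_iff hm).1 (hx.congr (Filter.Eventually.of_forall fun t => ?_))
  show (B.indicator f ∘ e.symm) (x, t) = _
  rw [Function.comp_apply, he_symm]
  exact (Set.indicator_comp_right (fun t : ℝ => (Fin.snoc x t : Fin (N + 1) → ℝ)) (g := f)).symm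

/-- the open unit square `(0,1)²` (copy of §21c) -/
def Sq : Set (Fin 2 → ℝ) := {y | 0 < y 0 ∧ y 0 < 1 ∧ 0 < y 1 ∧ y 1 < 1}

/-- Auxiliary step `isOpen_Sq`. [bookkeeping] -/
theorem isOpen_Sq : IsOpen Sq := by
  have h0 : Continuous fun y : Fin 2 → ℝ => y 0 := continuous_apply 0
  have h1 : Continuous fun y : Fin 2 → ℝ => y 1 := continuous_apply 1
  simp only [Sq, Set.setOf_and]
  exact (isOpen_lt continuous_const h0).inter ((isOpen_lt h0 continuous_const).inter
    ((isOpen_lt continuous_const h1).inter (isOpen_lt h1 continuous_const)))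

/-- `Sq` is measurable. [bookkeeping] -/
theorem measurableSet_Sq : MeasurableSet Sq := isOpen_Sq.measurableSet

/-- Auxiliary step `snoc_two_zero`. [bookkeeping] -/
private theorem snoc_two_zero (x : Fin 2 → ℝ) (t : ℝ) : (Fin.snoc x t : Fin 3 → ℝ) 0 = x 0 := rfl
/-- Auxiliary step `snoc_two_one`. [bookkeeping] -/
private theorem snoc_two_one (x : Fin 2 → ℝ) (t : ℝ) : (Fin.snoc x t : Fin 3 → ℝ) 1 = x 1 := rfl
/-- Auxiliary step `snoc_two_two`. [bookkeeping] -/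
private theorem snoc_two_two (x : Fin 2 → ℝ) (t : ℝ) : (Fin.snoc x t : Fin 3 → ℝ) 2 = t := rfl

/-! ## §23  NECESSITY IN DIMENSION 3, continued (gen 11): the two VERTEX orders and the three EDGE orders of a reduced datum.
Integrability of `P/(t₀^{β₀} t₁^{β₁} (1-t₁)^{γ₁} (1-t₂)^{γ₂} (t₀-t₂)^{α})` on `Δ₃` forces, monomial by monomial,
`β₀+β₁+α ≤ |e|+2` (vertex `(0,0,0)`), `β₁ ≤ e₁+e₂+1` (edge `t₁=t₂=0`) for `e ∈ supp P`; the same for the dual datum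
`P^σ = P(1-t₂,1-t₁,1-t₀)` with `(γ₂,γ₁)` in place of `(β₀,β₁)` (vertex `(1,1,1)`, edge `t₀=t₁=1`); and `α ≤ e₁+e₂+1` for
`e ∈ supp P^τ`, `P^τ = P(t₀,t₀-t₂,t₀-t₁)` (the diagonal edge `t₀=t₁=t₂`, carried onto `t₁=t₂=0` by `τ₀₁`).  With all orders `0` these
five conditions are exactly the low-pole layer `IsLayerThree`.  Tool: the polynomial chart `Ψ₃(x₀,x₁,s) = (s, s·x₀, s·x₀·x₁)` of `Δ₃` by
the open CUBE (Jacobian `s²x₀`; the vertex becomes the cube face `s = 0`, the edge `t₁=t₂=0` the face `x₀ = 0`), a lift of monomials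
absorbing the Jacobian (§21d pattern), and the face lemma §22c on the cube.  No move of the calculus is used. -/

section OrdersThree

/-! ### 23a  The open cube, the vertex chart and the coordinate swap -/

/-- the open unit cube `(0,1)³` -/
def Cube3 : Set (Fin 3 → ℝ) := {y | 0 < y 0 ∧ y 0 < 1 ∧ 0 < y 1 ∧ y 1 < 1 ∧ 0 < y 2 ∧ y 2 < 1}

/-- Auxiliary step `isOpen_Cube3`. [bookkeeping] -/
theorem isOpen_Cube3 : IsOpen Cube3 := by
  have h0 : Continuous fun y : Fin 3 → ℝ => y 0 := continuous_apply 0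
  have h1 : Continuous fun y : Fin 3 → ℝ => y 1 := continuous_apply 1
  have h2 : Continuous fun y : Fin 3 → ℝ => y 2 := continuous_apply 2
  simp only [Cube3, Set.setOf_and]
  exact (isOpen_lt continuous_const h0).inter ((isOpen_lt h0 continuous_const).inter
    ((isOpen_lt continuous_const h1).inter ((isOpen_lt h1 continuous_const).inter
    ((isOpen_lt continuous_const h2).inter (isOpen_lt h2 continuous_const)))))

/-- `Cube3` is measurable. [bookkeeping] -/
theorem measurableSet_Cube3 : MeasurableSet Cube3 := isOpen_Cube3.measurableSet

/-- Auxiliary step `sq_nonempty`. [bookkeeping] -/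
theorem sq_nonempty : Sq.Nonempty := ⟨![1/2, 1/2], by norm_num [Sq]⟩

/-- Auxiliary step `snoc_section_Cube3`. [bookkeeping] -/
theorem snoc_section_Cube3 {x : Fin 2 → ℝ} (hx : x ∈ Sq) :
    {s : ℝ | (Fin.snoc x s : Fin 3 → ℝ) ∈ Cube3} = Ioo 0 1 := by
  obtain ⟨h0, h01, h1, h11⟩ := hx
  ext s
  simp only [mem_setOf_eq, Cube3, snoc_two_zero, snoc_two_one, snoc_two_two, mem_Ioo]
  exact ⟨fun h => ⟨h.2.2.2.2.1, h.2.2.2.2.2⟩, fun h => ⟨h0, h01, h1, h11, h.1, h.2⟩⟩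

/-- **the face lemma on the cube** (face `y₂ = 0`, base the open square): §22c instantiated -/
theorem cube_face (D : (Fin 3 → ℝ) → ℝ) (hDc : ∀ x ∈ Sq, ContinuousAt (fun s : ℝ => D (Fin.snoc x s)) 0)
    (hD0 : ∀ x ∈ Sq, D (Fin.snoc x (0:ℝ)) ≠ 0) (b : ℕ) (L : MvPolynomial (Fin 3) ℚ)
    (h : IntegrableOn (fun y => MvPolynomial.aeval y L / (y 2 ^ b * D y)) Cube3) : ∀ e ∈ L.support, b ≤ e 2 :=
  face_lemma3 measurableSet_Cube3 (fun _ hy => hy.2.2.2.2.1.ne') isOpen_Sq sq_nonempty (fun _ => 1)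
    (fun _ hx => snoc_section_Cube3 hx) (fun _ _ => ⟨one_pos, le_rfl⟩) D hDc hD0 b L h

/-- the VERTEX CHART `Ψ₃(y) = (y₂, y₂·y₀, y₂·y₀·y₁)`: the open cube onto `Δ₃`, the face `y₂ = 0` onto the vertex `(0,0,0)` -/
def vΨ (y : Fin 3 → ℝ) : Fin 3 → ℝ := ![y 2, y 2 * y 0, y 2 * y 0 * y 1]

/-- Auxiliary step `vΨ_zero`. [bookkeeping] -/
theorem vΨ_zero (y : Fin 3 → ℝ) : vΨ y 0 = y 2 := by simp [vΨ]
/-- Auxiliary step `vΨ_one`. [bookkeeping] -/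
theorem vΨ_one (y : Fin 3 → ℝ) : vΨ y 1 = y 2 * y 0 := by simp [vΨ]
/-- Auxiliary step `vΨ_two`. [bookkeeping] -/
theorem vΨ_two (y : Fin 3 → ℝ) : vΨ y 2 = y 2 * y 0 * y 1 := by simp [vΨ]

/-- the rows of `DΨ₃(y)` -/
def vRow (y : Fin 3 → ℝ) : Fin 3 → ((Fin 3 → ℝ) →L[ℝ] ℝ) :=
  ![Pj3 2, y 2 • Pj3 0 + y 0 • Pj3 2, (y 2 * y 0) • Pj3 1 + y 1 • (y 2 • Pj3 0 + y 0 • Pj3 2)]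

/-- `DΨ₃(y)` -/
def vL (y : Fin 3 → ℝ) : (Fin 3 → ℝ) →L[ℝ] (Fin 3 → ℝ) := ContinuousLinearMap.pi (vRow y)

/-- Auxiliary step `vL_apply_zero`. [bookkeeping] -/
theorem vL_apply_zero (y h : Fin 3 → ℝ) : vL y h 0 = h 2 := by simp [vL, vRow]
/-- Auxiliary step `vL_apply_one`. [bookkeeping] -/
theorem vL_apply_one (y h : Fin 3 → ℝ) : vL y h 1 = y 2 * h 0 + y 0 * h 2 := by simp [vL, vRow]
/-- Auxiliary step `vL_apply_two`. [bookkeeping] -/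
theorem vL_apply_two (y h : Fin 3 → ℝ) : vL y h 2 = y 2 * y 0 * h 1 + y 1 * (y 2 * h 0 + y 0 * h 2) := by
  simp [vL, vRow]
  ring

/-- Auxiliary step `hasFDerivAt_vΨ`. [bookkeeping] -/
theorem hasFDerivAt_vΨ (y : Fin 3 → ℝ) : HasFDerivAt vΨ (vL y) y := by
  have h0 : HasFDerivAt (fun q : Fin 3 → ℝ => q 0) (Pj3 0) y := hasFDerivAt_apply (𝕜 := ℝ) 0 y
  have h1 : HasFDerivAt (fun q : Fin 3 → ℝ => q 1) (Pj3 1) y := hasFDerivAt_apply (𝕜 := ℝ) 1 y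
  have h2 : HasFDerivAt (fun q : Fin 3 → ℝ => q 2) (Pj3 2) y := hasFDerivAt_apply (𝕜 := ℝ) 2 y
  have c1 : HasFDerivAt (fun q : Fin 3 → ℝ => q 2 * q 0) (y 2 • Pj3 0 + y 0 • Pj3 2) y := h2.mul h0
  have c2 : HasFDerivAt (fun q : Fin 3 → ℝ => q 2 * q 0 * q 1)
      ((y 2 * y 0) • Pj3 1 + y 1 • (y 2 • Pj3 0 + y 0 • Pj3 2)) y := c1.mul h1
  have key : HasFDerivAt (fun q : Fin 3 → ℝ => fun i => (![q 2, q 2 * q 0, q 2 * q 0 * q 1] : Fin 3 → ℝ) i)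
      (ContinuousLinearMap.pi (vRow y)) y := by
    refine hasFDerivAt_pi.2 fun i => ?_
    fin_cases i
    · simpa [vRow] using h2
    · simpa [vRow] using c1
    · simpa [vRow] using c2
  exact key

/-- the Jacobian matrix of `Ψ₃` -/
def vM (y : Fin 3 → ℝ) : Matrix (Fin 3) (Fin 3) ℝ := !![0, 0, 1; y 2, 0, y 0; y 1 * y 2, y 2 * y 0, y 1 * y 0]

/-- Auxiliary step `vL_eq_toLin'`. [bookkeeping] -/
theorem vL_eq_toLin' (y : Fin 3 → ℝ) :
    (vL y : (Fin 3 → ℝ) →ₗ[ℝ] (Fin 3 → ℝ)) = Matrix.toLin' (vM y) := by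
  apply LinearMap.ext
  intro h
  rw [Matrix.toLin'_apply, ContinuousLinearMap.coe_coe]
  funext i
  fin_cases i
  · simp [vL_apply_zero, vM, Matrix.mulVec, dotProduct, Fin.sum_univ_three]
  · simp [vL_apply_one, vM, Matrix.mulVec, dotProduct, Fin.sum_univ_three]
  · simp [vL_apply_two, vM, Matrix.mulVec, dotProduct, Fin.sum_univ_three]
    ring

/-- Auxiliary step `det_vL`. [bookkeeping] -/
theorem det_vL (y : Fin 3 → ℝ) : (vL y).det = y 2 ^ 2 * y 0 := by
  show LinearMap.det (vL y : (Fin 3 → ℝ) →ₗ[ℝ] (Fin 3 → ℝ)) = _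
  rw [vL_eq_toLin', LinearMap.det_toLin', vM, Matrix.det_fin_three]
  simp
  ring

/-- Auxiliary step `vΨ_mem`. [bookkeeping] -/
theorem vΨ_mem {y : Fin 3 → ℝ} (hy : y ∈ Cube3) : vΨ y ∈ KZ.openOrderedSimplex 3 := by
  obtain ⟨h0, h01, h1, h11, h2, h21⟩ := hy
  rw [mem_simplex_three_iff, vΨ_zero, vΨ_one, vΨ_two]
  have h20 : 0 < y 2 * y 0 := mul_pos h2 h0
  exact ⟨mul_pos h20 h1, by nlinarith, by nlinarith, h21⟩

/-- Auxiliary step `injOn_vΨ`. [bookkeeping] -/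
theorem injOn_vΨ : InjOn vΨ Cube3 := by
  intro y hy y' hy' h
  have e2 : y 2 = y' 2 := by
    have := congrFun h 0
    rwa [vΨ_zero, vΨ_zero] at this
  have e0 : y 0 = y' 0 := by
    have := congrFun h 1
    rw [vΨ_one, vΨ_one, ← e2] at this
    exact mul_left_cancel₀ hy.2.2.2.2.1.ne' this
  have e1 : y 1 = y' 1 := by
    have := congrFun h 2
    rw [vΨ_two, vΨ_two, ← e2, ← e0] at this
    exact mul_left_cancel₀ (mul_pos hy.2.2.2.2.1 hy.1).ne' this
  funext i
  fin_cases i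
  · exact e0
  · exact e1
  · exact e2

/-- Auxiliary step `image_vΨ`. [bookkeeping] -/
theorem image_vΨ : vΨ '' Cube3 = KZ.openOrderedSimplex 3 := by
  ext t
  constructor
  · rintro ⟨y, hy, rfl⟩
    exact vΨ_mem hy
  · intro ht
    obtain ⟨h2, h21, h10, h0⟩ := (mem_simplex_three_iff t).1 ht
    have ht1 : 0 < t 1 := h2.trans h21
    have ht0 : 0 < t 0 := ht1.trans h10
    have ht0' : t 0 ≠ 0 := ht0.ne'
    have ht1' : t 1 ≠ 0 := ht1.ne'
    refine ⟨![t 1 / t 0, t 2 / t 1, t 0], ?_, ?_⟩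
    · simp only [Cube3, mem_setOf_eq, Matrix.cons_val_zero, Matrix.cons_val_one, Matrix.head_cons, Matrix.cons_val_two,
        Matrix.tail_cons]
      exact ⟨by positivity, by rwa [div_lt_one ht0], by positivity, by rwa [div_lt_one ht1], ht0, h0⟩
    · funext i
      fin_cases i <;> simp [vΨ] <;> field_simp

/-- **the vertex blow-up pull-back**: `F` integrable on `Δ₃` ⟹ `y ↦ y₂²y₀·F(Ψ₃ y)` integrable on the cube -/
theorem integrableOn_vchart {F : (Fin 3 → ℝ) → ℝ} (hF : IntegrableOn F (KZ.openOrderedSimplex 3)) :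
    IntegrableOn (fun y => y 2 ^ 2 * y 0 * F (vΨ y)) Cube3 := by
  have key := (integrableOn_image_iff_integrableOn_abs_det_fderiv_smul (μ := volume) measurableSet_Cube3
    (fun y _ => (hasFDerivAt_vΨ y).hasFDerivWithinAt) injOn_vΨ F).1 (by rw [image_vΨ]; exact hF)
  refine key.congr_fun (fun y hy => ?_) measurableSet_Cube3
  have hy0 := hy.1
  have hy2 := hy.2.2.2.2.1
  show |(vL y).det| • F (vΨ y) = y 2 ^ 2 * y 0 * F (vΨ y)
  rw [det_vL, abs_of_pos (by positivity), smul_eq_mul]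

/-- a `C¹` involution `Φ` of a measurable set `B` with constant derivative of `|det| = 1` transports integrability on `B` -/
theorem integrableOn_comp_invol {B : Set (Fin 3 → ℝ)} (hB : MeasurableSet B)
    {Φ : (Fin 3 → ℝ) → (Fin 3 → ℝ)} {L : (Fin 3 → ℝ) →L[ℝ] (Fin 3 → ℝ)}
    (hd : ∀ x, HasFDerivAt Φ L x) (hL : |L.det| = 1) (hinv : ∀ z, Φ (Φ z) = z) (hmem : ∀ z ∈ B, Φ z ∈ B)
    {F : (Fin 3 → ℝ) → ℝ} (hF : IntegrableOn F B) : IntegrableOn (fun z => F (Φ z)) B := by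
  have himage : Φ '' B = B := by
    ext u
    constructor
    · rintro ⟨z, hz, rfl⟩
      exact hmem z hz
    · intro hu
      exact ⟨Φ u, hmem u hu, hinv u⟩
  have key := (integrableOn_image_iff_integrableOn_abs_det_fderiv_smul (μ := volume) hB
    (fun x _ => (hd x).hasFDerivWithinAt) (fun a _ b _ h => by
      have := congrArg Φ h
      rwa [hinv, hinv] at this) (fun z => F (Φ z))).2
    (hF.congr_fun (fun p _ => by simp [hL, hinv]) hB)
  rwa [himage] at key

/-- the coordinate swap `(y₀,y₁,y₂) ↦ (y₂,y₁,y₀)` of the cube -/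
def sw02 (y : Fin 3 → ℝ) : Fin 3 → ℝ := ![y 2, y 1, y 0]
/-- the swap as a continuous linear map -/
def sw02L : (Fin 3 → ℝ) →L[ℝ] (Fin 3 → ℝ) := ContinuousLinearMap.pi ![Pj3 2, Pj3 1, Pj3 0]

/-- Auxiliary step `sw02_zero`. [bookkeeping] -/
theorem sw02_zero (y : Fin 3 → ℝ) : sw02 y 0 = y 2 := by simp [sw02]
/-- Auxiliary step `sw02_one`. [bookkeeping] -/
theorem sw02_one (y : Fin 3 → ℝ) : sw02 y 1 = y 1 := by simp [sw02]
/-- Auxiliary step `sw02_two`. [bookkeeping] -/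
theorem sw02_two (y : Fin 3 → ℝ) : sw02 y 2 = y 0 := by simp [sw02]

/-- Auxiliary step `sw02_eq_L`. [bookkeeping] -/
theorem sw02_eq_L (y : Fin 3 → ℝ) : sw02 y = sw02L y := by
  funext i
  fin_cases i <;> simp [sw02, sw02L]

/-- Auxiliary step `sw02_sw02`. [bookkeeping] -/
theorem sw02_sw02 (y : Fin 3 → ℝ) : sw02 (sw02 y) = y := by
  funext i
  fin_cases i <;> simp [sw02_zero, sw02_one, sw02_two]

/-- Auxiliary step `sw02L_sw02L`. [bookkeeping] -/
theorem sw02L_sw02L (w : Fin 3 → ℝ) : sw02L (sw02L w) = w := by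
  rw [← sw02_eq_L, ← sw02_eq_L, sw02_sw02]

/-- Auxiliary step `hasFDerivAt_sw02`. [bookkeeping] -/
theorem hasFDerivAt_sw02 (x : Fin 3 → ℝ) : HasFDerivAt sw02 sw02L x := by
  have e : sw02 = fun z => sw02L z := funext sw02_eq_L
  rw [e]
  exact sw02L.hasFDerivAt

/-- Membership in `Cube3_sw02`, unfolded. [bookkeeping] -/
theorem mem_Cube3_sw02 {y : Fin 3 → ℝ} (hy : y ∈ Cube3) : sw02 y ∈ Cube3 := by
  obtain ⟨h0, h01, h1, h11, h2, h21⟩ := hy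
  simp only [Cube3, mem_setOf_eq, sw02_zero, sw02_one, sw02_two]
  exact ⟨h2, h21, h1, h11, h0, h01⟩

/-- the EDGE CHART `Ψ₃'(y) = (y₀, y₀·y₂, y₀·y₂·y₁) = Ψ₃(swap y)`: the face `y₂ = 0` of the cube onto the edge `t₁ = t₂ = 0` -/
def eΨ (y : Fin 3 → ℝ) : Fin 3 → ℝ := ![y 0, y 0 * y 2, y 0 * y 2 * y 1]

/-- Auxiliary step `eΨ_zero`. [bookkeeping] -/
theorem eΨ_zero (y : Fin 3 → ℝ) : eΨ y 0 = y 0 := by simp [eΨ]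
/-- Auxiliary step `eΨ_one`. [bookkeeping] -/
theorem eΨ_one (y : Fin 3 → ℝ) : eΨ y 1 = y 0 * y 2 := by simp [eΨ]
/-- Auxiliary step `eΨ_two`. [bookkeeping] -/
theorem eΨ_two (y : Fin 3 → ℝ) : eΨ y 2 = y 0 * y 2 * y 1 := by simp [eΨ]

/-- Auxiliary step `vΨ_sw02`. [bookkeeping] -/
theorem vΨ_sw02 (y : Fin 3 → ℝ) : vΨ (sw02 y) = eΨ y := by
  funext i
  fin_cases i <;> simp [vΨ, sw02, eΨ]

/-- Auxiliary step `eΨ_mem`. [bookkeeping] -/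
theorem eΨ_mem {y : Fin 3 → ℝ} (hy : y ∈ Cube3) : eΨ y ∈ KZ.openOrderedSimplex 3 := by
  rw [← vΨ_sw02]
  exact vΨ_mem (mem_Cube3_sw02 hy)

/-- **the edge blow-up pull-back**: `F` integrable on `Δ₃` ⟹ `y ↦ y₀²y₂·F(Ψ₃' y)` integrable on the cube -/
theorem integrableOn_echart {F : (Fin 3 → ℝ) → ℝ} (hF : IntegrableOn F (KZ.openOrderedSimplex 3)) :
    IntegrableOn (fun y => y 0 ^ 2 * y 2 * F (eΨ y)) Cube3 := by
  have h := integrableOn_comp_invol measurableSet_Cube3 hasFDerivAt_sw02 (abs_det_of_invol sw02L_sw02L) sw02_sw02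
    (fun _ hy => mem_Cube3_sw02 hy) (integrableOn_vchart hF)
  refine h.congr_fun (fun y _ => ?_) measurableSet_Cube3
  show (sw02 y) 2 ^ 2 * (sw02 y) 0 * F (vΨ (sw02 y)) = y 0 ^ 2 * y 2 * F (eΨ y)
  rw [sw02_two, sw02_zero, vΨ_sw02]

/-! ### 23b  Lifts of monomials through the charts -/

/-- the polynomial with the monomial `e` of `P` replaced by the monomial `f e` (same coefficient) -/
noncomputable def lift3 (f : (Fin 3 →₀ ℕ) → (Fin 3 →₀ ℕ)) (P : MvPolynomial (Fin 3) ℚ) : MvPolynomial (Fin 3) ℚ :=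
  ∑ e ∈ P.support, MvPolynomial.monomial (f e) (MvPolynomial.coeff e P)

/-- Auxiliary step `aeval_lift3`. [bookkeeping] -/
theorem aeval_lift3 (f : (Fin 3 →₀ ℕ) → (Fin 3 →₀ ℕ)) (P : MvPolynomial (Fin 3) ℚ) (y : Fin 3 → ℝ) :
    MvPolynomial.aeval y (lift3 f P) =
      ∑ e ∈ P.support, ((MvPolynomial.coeff e P : ℚ) : ℝ) * (y 0 ^ (f e 0) * y 1 ^ (f e 1) * y 2 ^ (f e 2)) := by
  rw [lift3, map_sum]
  refine Finset.sum_congr rfl fun e _ => ?_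
  rw [MvPolynomial.aeval_monomial, Finsupp.prod_pow, Fin.prod_univ_three]
  simp [eq_ratCast]

end OrdersThree
end Summit.KontsevichZagierPeriods.KontsevichZagierPeriods.Theorems.RootDecompZetaThreeFrontierWordMoves
end
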